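import Mathlib.NumberTheory.Chebyshev
import Mathlib.Algebra.BigOperators.Module
import Mathlib.Analysis.Complex.ExponentialBounds
import HarnessLib

/-!
# Route `ChenParityOracleBLAP` — crux S1 = `HostParityFromBrick` (stmt-Parity-20045): from primes to von Mangoldt weights

Support file for the prime half `K1 → K2 → HP1` of S1: partial summation converting a family of
sums over primes `∑_{p ≤ x} f_a(p)` (`|f_a| ≤ 1`) into von-Mangoldt-weighted sums at all heights,
with the prime powers removed by Chebyshev's bound `ψ − θ ≤ 2√x log x`
(`sum_abs_primes_le_abel`):
`∑_a |∑_{p ≤ x} f_a(p)| ≤ (1/log x) ∑_a |∑_{k ≤ x} Λ(k) f_a(k)|`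
`  + ∑_{i < x} |1/log i − 1/log(i+1)| ∑_a |∑_{k ≤ i} Λ(k) f_a(k)| + 8 #ι √x log x`,
and `∑_{i<x} |1/log i − 1/log(i+1)| ≤ 3` (`sum_abs_logWeights_le`).

References: H. Iwaniec, E. Kowalski, *Analytic Number Theory* (2004), §1.5, §13.4
[IwaniecKowalski2004].
-/

namespace Summit.Parity.GeneralizedHardyLittlewood.Theorems

open Finset Real
open ArithmeticFunction (vonMangoldt)

/-- The Abel weights `w_i = 1/log i − 1/log(i+1)` (with `1/log 0 = 1/log 1 = 0`) satisfy
`∑_{i<x} |w_i| ≤ 3`. -/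
theorem sum_abs_logWeights_le (x : ℕ) :
    ∑ i ∈ range x, |1 / Real.log i - 1 / Real.log (i + 1)| ≤ 3 := by
  have hlog2 : 0.6931471803 < Real.log 2 := Real.log_two_gt_d9
  have hl2 : 0 < Real.log 2 := by linarith
  -- pointwise: `|w i| ≤ w i + [i = 1] 2/log 2`
  have hpt : ∀ i ∈ range x, |1 / Real.log i - 1 / Real.log (i + 1)| ≤
      (1 / Real.log i - 1 / Real.log (i + 1)) + if i = 1 then 2 / Real.log 2 else 0 := by
    intro i _
    rcases Nat.lt_or_ge i 2 with hi | hi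
    · interval_cases i
      · simp
      · simp only [Nat.cast_one, Real.log_one, div_zero, zero_sub, if_true]
        rw [show (1 : ℝ) + 1 = 2 by norm_num, abs_neg, abs_of_pos (by positivity)]
        have : 0 < 1 / Real.log 2 := by positivity
        have e : 2 / Real.log 2 = 2 * (1 / Real.log 2) := by ring
        rw [e]; linarith
    · have hi2 : (2 : ℝ) ≤ i := by exact_mod_cast hi
      have hli : 0 < Real.log i := Real.log_pos (by linarith)
      have hmono : Real.log i ≤ Real.log (i + 1) := Real.log_le_log (by linarith) (by linarith)
      have hw : 0 ≤ 1 / Real.log i - 1 / Real.log (i + 1) := by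
        rw [sub_nonneg]; exact one_div_le_one_div_of_le hli hmono
      rw [abs_of_nonneg hw, if_neg (by omega), add_zero]
  refine (Finset.sum_le_sum hpt).trans ?_
  rw [Finset.sum_add_distrib]
  have htel : ∑ i ∈ range x, (1 / Real.log i - 1 / Real.log (i + 1)) = -(1 / Real.log x) := by
    have h := Finset.sum_range_sub (fun i : ℕ => -(1 / Real.log (i : ℝ))) x
    simp only [Nat.cast_zero, Real.log_zero, div_zero, neg_zero, sub_zero] at h
    rw [← h]
    refine Finset.sum_congr rfl fun i _ => ?_
    push_cast; ring
  rw [htel]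
  have hite : ∑ i ∈ range x, (if i = 1 then 2 / Real.log 2 else (0 : ℝ)) ≤ 2 / Real.log 2 := by
    rw [Finset.sum_ite_eq']
    split_ifs
    · exact le_rfl
    · positivity
  have hx0 : 0 ≤ 1 / Real.log x := by
    rcases Nat.lt_or_ge x 2 with h | h
    · interval_cases x <;> simp
    · exact div_nonneg zero_le_one (Real.log_nonneg (by exact_mod_cast (by omega : 1 ≤ x)))
  have h3 : 2 / Real.log 2 ≤ 3 := by rw [div_le_iff₀ hl2]; linarith
  linarith

/-- Prime powers: `|∑_{k ≤ i} (1_{k prime} log k − Λ(k)) f(k)| ≤ 2 √i log i` for `|f| ≤ 1`. -/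
theorem abs_sum_primeLog_sub_vonMangoldt_le (f : ℕ → ℝ) (hf : ∀ k, |f k| ≤ 1) (i : ℕ) :
    |∑ k ∈ range (i + 1), ((if k.Prime then Real.log k else 0) - vonMangoldt k) * f k| ≤
      2 * Real.sqrt i * Real.log i := by
  rcases Nat.eq_zero_or_pos i with rfl | hi
  · simp
  have hpt : ∀ k ∈ range (i + 1), |((if k.Prime then Real.log k else 0) - vonMangoldt k) * f k| ≤
      vonMangoldt k - (if k.Prime then Real.log k else 0) := by
    intro k _
    rw [abs_mul]
    have h1 : (if k.Prime then Real.log k else 0) ≤ vonMangoldt k := by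
      split_ifs with hp
      · rw [ArithmeticFunction.vonMangoldt_apply_prime hp]
      · exact ArithmeticFunction.vonMangoldt_nonneg
    calc |((if k.Prime then Real.log k else 0) - vonMangoldt k)| * |f k|
        ≤ |((if k.Prime then Real.log k else 0) - vonMangoldt k)| * 1 :=
          mul_le_mul_of_nonneg_left (hf k) (abs_nonneg _)
      _ = vonMangoldt k - (if k.Prime then Real.log k else 0) := by
          rw [mul_one, abs_sub_comm, abs_of_nonneg (by linarith)]
  refine (Finset.abs_sum_le_sum_abs _ _).trans ((Finset.sum_le_sum hpt).trans ?_)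
  -- `= ψ i − θ i ≤ 2 √i log i`
  have hIcc : Icc 0 i = range (i + 1) := by
    ext k; simp only [Finset.mem_Icc, Finset.mem_range, Nat.zero_le, true_and]; omega
  have hpsi : Chebyshev.psi i - Chebyshev.theta i =
      ∑ k ∈ range (i + 1), (vonMangoldt k - (if k.Prime then Real.log k else 0)) := by
    rw [Chebyshev.psi_eq_sum_Icc, Chebyshev.theta_eq_sum_Icc, Nat.floor_natCast, Finset.sum_filter,
      ← Finset.sum_sub_distrib, hIcc]
  rw [← hpsi]
  exact Chebyshev.psi_sub_theta_le (by exact_mod_cast hi)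

/-- **From primes to von Mangoldt weights (Abel summation + Chebyshev).**  For a finite family
`f_a : ℕ → ℝ` with `|f_a| ≤ 1` and `x ≥ 3`:
`∑_a |∑_{p ≤ x} f_a(p)| ≤ (1/log x) ∑_a |∑_{k ∈ [1,x]} Λ(k) f_a(k)|`
`+ ∑_{i<x} |1/log i − 1/log(i+1)| ∑_a |∑_{k ∈ [1,i]} Λ(k) f_a(k)| + 8 #ι √x log x`
[cite: IwaniecKowalski2004, Section 1.5]. -/
theorem sum_abs_primes_le_abel {α : Type*} (ι : Finset α) (f : α → ℕ → ℝ)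
    (hf : ∀ a k, |f a k| ≤ 1) {x : ℕ} (hx : 3 ≤ x) :
    ∑ a ∈ ι, |∑ p ∈ Nat.primesLE x, f a p| ≤
      (1 / Real.log x) * ∑ a ∈ ι, |∑ k ∈ Icc 1 x, vonMangoldt k * f a k| +
      ∑ i ∈ range x, |1 / Real.log i - 1 / Real.log (i + 1)| *
        ∑ a ∈ ι, |∑ k ∈ Icc 1 i, vonMangoldt k * f a k| +
      #ι * (8 * Real.sqrt x * Real.log x) := by
  classical
  have hx1 : (1 : ℝ) ≤ x := by exact_mod_cast (by omega : 1 ≤ x)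
  have hx3 : (3 : ℝ) ≤ x := by exact_mod_cast hx
  have hlogx : 1 ≤ Real.log x := by
    rw [← Real.log_exp 1]
    refine Real.log_le_log (Real.exp_pos 1) ?_
    have := Real.exp_one_lt_d9; linarith
  have hlogx0 : 0 < Real.log x := by linarith
  set w : ℕ → ℝ := fun i => 1 / Real.log i - 1 / Real.log (i + 1) with hw
  set E : ℝ := 2 * Real.sqrt x * Real.log x with hE
  have hE0 : 0 ≤ E := by positivity
  have hW := sum_abs_logWeights_le x
  -- `U a i = ∑_{k ∈ [1,i]} Λ f = ∑_{k < i+1} Λ f`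
  have hU : ∀ a i, ∑ k ∈ Icc 1 i, vonMangoldt k * f a k =
      ∑ k ∈ range (i + 1), vonMangoldt k * f a k := by
    intro a i
    have : range (i + 1) = insert 0 (Icc 1 i) := by
      ext k; simp only [Finset.mem_range, Finset.mem_insert, Finset.mem_Icc]; omega
    rw [this, Finset.sum_insert (by simp), ArithmeticFunction.map_zero, zero_mul, zero_add]
  -- errors `e i = 2 √i log i ≤ E` for `i < x`
  have he : ∀ i ∈ range x, 2 * Real.sqrt i * Real.log i ≤ E := by
    intro i hi
    rw [Finset.mem_range] at hi
    rcases Nat.eq_zero_or_pos i with rfl | hi0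
    · rw [Nat.cast_zero, Real.log_zero, mul_zero]; exact hE0
    · have hi1 : (1 : ℝ) ≤ i := by exact_mod_cast hi0
      have hix : (i : ℝ) ≤ x := by exact_mod_cast hi.le
      rw [hE]
      exact mul_le_mul (mul_le_mul_of_nonneg_left (Real.sqrt_le_sqrt hix) (by norm_num))
        (Real.log_le_log (by linarith) hix) (Real.log_nonneg hi1) (by positivity)
  -- single `a`
  have hsingle : ∀ a ∈ ι, |∑ p ∈ Nat.primesLE x, f a p| ≤
      (1 / Real.log x) * |∑ k ∈ Icc 1 x, vonMangoldt k * f a k| +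
      ∑ i ∈ range x, |w i| * |∑ k ∈ Icc 1 i, vonMangoldt k * f a k| +
        8 * Real.sqrt x * Real.log x := by
    intro a _
    set P : ℕ → ℝ := fun k => if k.Prime then Real.log k * f a k else 0 with hP
    set T : ℕ → ℝ := fun m => ∑ k ∈ range (m + 1), P k with hT
    set U : ℕ → ℝ := fun m => ∑ k ∈ Icc 1 m, vonMangoldt k * f a k with hUdef
    -- the prime sum as a weighted sum
    have h1 : ∑ p ∈ Nat.primesLE x, f a p = ∑ k ∈ range (x + 1), (1 / Real.log k) • P k := by
      rw [Nat.primesLE, Nat.primesBelow, Finset.sum_filter]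
      refine Finset.sum_congr rfl fun k _ => ?_
      simp only [hP, smul_eq_mul]
      split_ifs with hp
      · have : Real.log k ≠ 0 := (Real.log_pos (by exact_mod_cast hp.one_lt)).ne'
        field_simp
      · rw [mul_zero]
    -- Abel summation
    have h2 := Finset.sum_range_by_parts (fun k => 1 / Real.log (k : ℕ)) P (x + 1)
    have hG : ∀ m, ∑ k ∈ range (m + 1), P k = T m := fun m => rfl
    rw [h1, h2]
    simp only [Nat.add_sub_cancel, smul_eq_mul, hG]
    -- `|T i| ≤ |U i| + 2 √i log i`
    have hTU : ∀ i, |T i| ≤ |U i| + 2 * Real.sqrt i * Real.log i := by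
      intro i
      have hd := abs_sum_primeLog_sub_vonMangoldt_le (f a) (hf a) i
      have heq : T i - U i =
          ∑ k ∈ range (i + 1), ((if k.Prime then Real.log k else 0) - vonMangoldt k) * f a k := by
        simp only [hT, hUdef]
        rw [hU, ← Finset.sum_sub_distrib]
        refine Finset.sum_congr rfl fun k _ => ?_
        simp only [hP]; split_ifs <;> ring
      have := abs_sub_abs_le_abs_sub (T i) (U i)
      rw [heq] at this
      linarith
    have hstep : |1 / Real.log ((x : ℕ) : ℝ) * T x - ∑ i ∈ range x, (1 / Real.log ((i + 1 : ℕ) : ℝ) -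
        1 / Real.log ((i : ℕ) : ℝ)) * T i| ≤
        1 / Real.log x * |T x| + ∑ i ∈ range x, |w i| * |T i| := by
      refine (abs_sub _ _).trans ?_
      rw [abs_mul, abs_of_pos (by positivity : (0:ℝ) < 1 / Real.log ((x : ℕ) : ℝ))]
      refine add_le_add le_rfl ((Finset.abs_sum_le_sum_abs _ _).trans
        (Finset.sum_le_sum fun i _ => ?_))
      rw [abs_mul]
      refine mul_le_mul_of_nonneg_right (le_of_eq ?_) (abs_nonneg _)
      rw [hw, abs_sub_comm]; push_cast; ring_nf
    refine hstep.trans ?_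
    have h3 : 1 / Real.log x * |T x| ≤ 1 / Real.log x * (|U x| + E) :=
      mul_le_mul_of_nonneg_left (hTU x) (by positivity)
    have h4 : ∑ i ∈ range x, |w i| * |T i| ≤ ∑ i ∈ range x, (|w i| * |U i| + |w i| * E) := by
      refine Finset.sum_le_sum fun i hi => ?_
      have := mul_le_mul_of_nonneg_left ((hTU i).trans (add_le_add le_rfl (he i hi))) (abs_nonneg (w i))
      linarith
    rw [Finset.sum_add_distrib, ← Finset.sum_mul] at h4
    have h5 : 1 / Real.log x * E = 2 * Real.sqrt x := by rw [hE]; field_simp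
    have h6 : (∑ i ∈ range x, |w i|) * E ≤ 3 * E := mul_le_mul_of_nonneg_right hW hE0
    have h7 : 2 * Real.sqrt x ≤ 2 * Real.sqrt x * Real.log x :=
      le_mul_of_one_le_right (by positivity) hlogx
    simp only [hUdef] at h3 h4 ⊢
    rw [mul_add, h5] at h3
    nlinarith [h3, h4, h6, h7, hE]
  -- sum over `a`
  refine (Finset.sum_le_sum hsingle).trans (le_of_eq ?_)
  rw [Finset.sum_add_distrib, Finset.sum_add_distrib, ← Finset.mul_sum, Finset.sum_const,
    nsmul_eq_mul, Finset.sum_comm]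
  simp_rw [← Finset.mul_sum]
  simp only [hw]

end Summit.Parity.GeneralizedHardyLittlewood.Theorems
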